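import Summits.QuantumFields.YangMills.Theses.LuscherReduction
import Summits.QuantumFields.YangMills.Theorems.LuscherReductionRunningReductionKTDefs
import HarnessLib

/-!
# Route `LuscherReduction`, item `DressedRitz` (stmt-QuantumFields-20205) — reduction chain, DEFINITIONS: the level-`k` slices of the typed cuts
# `RitzGenerators ∕ DiagonalPlateau ∕ ExcitedPlateau` (GEVP ∕ generator language) and `PlateauClauses ∕ OrthoPlateau ∕ OperatorPlateau` (operator
# language), plus the level-`k` slice of the route decl itself

Support DEFINITIONS of the `FemtoTransferGap` group (fleet service by seat ym-infvol-p2 g6; route `LuscherReduction`, femto rung R2b1; bears on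
the crux child `DressedRitz` = stmt-QuantumFields-20205 of RED `RunningReduction` stmt-QuantumFields-19978; route owner ym-beyond-p1 g19 ask (β)
«DressedRitz via `KTGen.dressedRitz_of_excitedPlateau`, rfl transport to the route decl»).  SOURCE: the planner's kernel-checked crux workfiles
`Summits/QuantumFields/YangMills/Cruxes/RunningReduction/Lines/DressedRitzGEVP.lean` (rev 3, sha16 8eae6de8b30412fb, seat ym-cruxidea-19978-1
GEN 4–5) and `…/Lines/OperatorPlateau.lean` (rev 2, same seat GEN 6), which are NOT importable on the farm.  There the cuts are CLOSED
propositions `∀ k, …`; here each is the `k`-indexed PREDICATE obtained by deleting the leading `∀ k : ℕ,` — texts otherwise BYTE-IDENTICAL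
(with the gauge group spelled `SU2` = `Theorems.FemtoTransferGap.SU2`, the same constant) — so that `KTGen.ExcitedPlateau ↔ ∀ k, ExcitedPlateauAt k`
etc. hold by `Iff.rfl`, and the reduction theorems of the companion files are stated LEVEL BY LEVEL (`ExcitedPlateauAt k → DressedRitzAt k`),
which is strictly more informative than the global implications.  `DressedRitzAt k` is the level-`k` slice of the ROUTE DECL
`Summit.QuantumFields.YangMills.Theses.LuscherReduction.DressedRitz` (certified here: `dressedRitz_iff_forall_dressedRitzAt := Iff.rfl`), not a
restatement under a new name: the companion files conclude the route decl BY NAME through it.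

Contents (namespace `…Theorems.FemtoTransferGap`):
* `KTGen.DressedRitzAt k` + `KTGen.dressedRitz_iff_forall_dressedRitzAt` (`Iff.rfl` against the route decl);
* `KTGen.RitzGeneratorsAt k` — generator ∕ GEVP form (g1)–(g4) (`DressedRitzGEVP.lean` §1);
* `KTGen.DiagonalPlateauAt k` — GEVP-free generator cut (p0)–(p6) (§7);
* `KTGen.ExcitedPlateauAt k` — excited-sector cut (x1)–(x7), vacuum generator EXACT (§9);
* `OpPlat.ins φ O = (O − ⟨φ, O·φ⟩)·φ` — vacuum-subtracted insertion applied to the vacuum (`OperatorPlateau.lean` §1);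
* `OpPlat.PlateauClauses k C β u` — the homogeneous clauses (o0)–(o7) (VERBATIM, it already was a predicate) (§2);
* `OpPlat.OrthoPlateauAt k`, `OpPlat.OperatorPlateauAt k` — the cut in homogeneous ∕ operator language (§2).
Reduction theorems: `Theorems/LuscherReductionDressedRitzOf{Generators,DiagonalPlateau,ExcitedPlateau,OperatorPlateau}.lean`.

HONEST FRAMING: fixed-lattice Rayleigh–Ritz ∕ GEVP bookkeeping on the femto rung R2b1; definitions only; proves nothing OF `DressedRitz` (the XL
renormalisation-group estimate); no bearing on infinite volume, the continuum limit or the Clay mass gap.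
References: M. Lüscher, NPB 219 (1983) 233 [cite: Luscher1983, §3]; Lüscher–Wolff, NPB 339 (1990) 222 [cite: LuscherWolff1990];
Reed–Simon IV, Thm. XIII.1 [cite: ReedSimonIV1978, Thm. XIII.1].
-/

set_option autoImplicit false

noncomputable section

open MeasureTheory Filter Topology Real
open Literature.MathematicalPhysics.QuantumFieldTheory
open Literature.MathematicalPhysics.QuantumLattice
open Literature.Analysis.OperatorTheory.YMMatrixModel
open scoped BigOperators

namespace Summit.QuantumFields.YangMills.Theorems.FemtoTransferGap

/-! ## §1 The level-`k` slice of the route decl `DressedRitz` and its generator ∕ GEVP form -/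

/-- **Level-`k` slice of the route decl `Theses.LuscherReduction.DressedRitz`** (item stmt-QuantumFields-20205; rev-3 residual-Gram form): for
every `η > 0`, eventually in the femto window, a PHYSICAL `l2`-ORTHONORMAL `qform`-DIAGONAL family `φ₀ … φ_k` with non-increasing Ritz values
`m_i`, (i) Ritz ratios in Lüscher position `e^{±Cλ²/L}` against the one-site ratios, (ii′) residual Gram bound `‖Σ c_i r_i‖² ≤ C(λ³/L²)m₀² Σ c_i²`,
(iii) coarse top capture.  `Theses.LuscherReduction.DressedRitz ↔ ∀ k, DressedRitzAt k` is `Iff.rfl` (`dressedRitz_iff_forall_dressedRitzAt`).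
[cite: Luscher1983, §3] -/
def KTGen.DressedRitzAt (k : ℕ) : Prop :=
  ∀ η : ℝ, 0 < η → ∃ C lam0 : ℝ, 0 < lam0 ∧ ∀ lam : ℝ, 0 < lam → lam ≤ lam0 →
    ∃ L0 : ℕ, ∀ (L : ℕ) [NeZero L], L0 ≤ L → ∀ β : ℝ, InFemtoWindow lam β L →
      ∃ φ : Fin (k + 1) → (GaugeConfig 3 L SU2 → ℝ),
        (∀ i, IsPhys (φ i)) ∧
        (∀ i l, l2 (φ i) (φ l) = if i = l then 1 else 0) ∧
        (∀ i l, i ≠ l → qform su2Rep β (φ i) (φ l) = 0) ∧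
        (∀ i l : Fin (k + 1), i ≤ l → qform su2Rep β (φ l) (φ l) ≤ qform su2Rep β (φ i) (φ i)) ∧
        (∀ j : Fin (k + 1),
          qform su2Rep β (φ j) (φ j) * levelValue su2Rep 1 (oneSiteCoupling β L) 0 ≤
              Real.exp (C * luscherLambda β L ^ 2 / L) *
                (levelValue su2Rep 1 (oneSiteCoupling β L) j * qform su2Rep β (φ 0) (φ 0)) ∧
            levelValue su2Rep 1 (oneSiteCoupling β L) j * qform su2Rep β (φ 0) (φ 0) ≤
              Real.exp (C * luscherLambda β L ^ 2 / L) *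
                (qform su2Rep β (φ j) (φ j) * levelValue su2Rep 1 (oneSiteCoupling β L) 0)) ∧
        (∀ c : Fin (k + 1) → ℝ,
          l2 (∑ i, c i • (transferApply β (φ i) - qform su2Rep β (φ i) (φ i) • φ i))
             (∑ i, c i • (transferApply β (φ i) - qform su2Rep β (φ i) (φ i) • φ i)) ≤
            C * (luscherLambda β L ^ 3 / (L : ℝ) ^ 2) * qform su2Rep β (φ 0) (φ 0) ^ 2 * ∑ i, c i ^ 2) ∧
        (∀ ψ : GaugeConfig 3 L SU2 → ℝ, IsPhys ψ →
          qform su2Rep β ψ ψ ≤ Real.exp (η * luscherLambda β L / L) * qform su2Rep β (φ 0) (φ 0) * l2 ψ ψ)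

/-- The route decl `DressedRitz` (stmt-QuantumFields-20205) IS the conjunction over `k` of its slices — definitionally. [folklore] -/
theorem KTGen.dressedRitz_iff_forall_dressedRitzAt :
    Summit.QuantumFields.YangMills.Theses.LuscherReduction.DressedRitz ↔ ∀ k : ℕ, KTGen.DressedRitzAt k :=
  Iff.rfl

/-- **`RitzGeneratorsAt k` — level-`k` slice of the generator ∕ GEVP form `KTGen.RitzGenerators`** (`DressedRitzGEVP.lean` §1): for every `η > 0`,
eventually in the femto window, `k+1` PHYSICAL UNIT VECTORS `v₀ … v_k` (no orthogonality, no diagonality) with (g1) Gram conditioning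
`Σ c_i² ≤ 2 ‖Σ c_i v_i‖²`; (g2) per-generator one-step residuals `‖K_β v_i − ⟨v_i,K_β v_i⟩ v_i‖² ≤ C (λ³/L²) m₀²`, `m₀ := ritzValue β v 0`;
(g3) the in-span min–max values `ritzValue` in Lüscher position (the GEVP eigenvalues of the correlator pencil `(⟨v_i,K_βv_l⟩, ⟨v_i,v_l⟩)`);
(g4) coarse top capture.  Equivalent to `DressedRitzAt k` (`…DressedRitzOfGenerators.lean`). [cite: LuscherWolff1990] -/
def KTGen.RitzGeneratorsAt (k : ℕ) : Prop :=
  ∀ η : ℝ, 0 < η → ∃ C lam0 : ℝ, 0 < lam0 ∧ ∀ lam : ℝ, 0 < lam → lam ≤ lam0 →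
    ∃ L0 : ℕ, ∀ (L : ℕ) [NeZero L], L0 ≤ L → ∀ β : ℝ, InFemtoWindow lam β L →
      ∃ v : Fin (k + 1) → (GaugeConfig 3 L SU2 → ℝ),
        (∀ i, IsPhys (v i)) ∧
        (∀ i, l2 (v i) (v i) = 1) ∧
        (∀ c : Fin (k + 1) → ℝ, ∑ i, c i ^ 2 ≤ 2 * l2 (∑ i, c i • v i) (∑ i, c i • v i)) ∧
        (∀ i, l2 (transferApply β (v i) - qform su2Rep β (v i) (v i) • v i)
                 (transferApply β (v i) - qform su2Rep β (v i) (v i) • v i) ≤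
            C * (luscherLambda β L ^ 3 / (L : ℝ) ^ 2) * ritzValue β v 0 ^ 2) ∧
        (∀ j : ℕ, j ≤ k →
          ritzValue β v j * levelValue su2Rep 1 (oneSiteCoupling β L) 0 ≤
              Real.exp (C * luscherLambda β L ^ 2 / L) * (levelValue su2Rep 1 (oneSiteCoupling β L) j * ritzValue β v 0) ∧
          levelValue su2Rep 1 (oneSiteCoupling β L) j * ritzValue β v 0 ≤
              Real.exp (C * luscherLambda β L ^ 2 / L) * (ritzValue β v j * levelValue su2Rep 1 (oneSiteCoupling β L) 0)) ∧
        (∀ ψ : GaugeConfig 3 L SU2 → ℝ, IsPhys ψ →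
          qform su2Rep β ψ ψ ≤ Real.exp (η * luscherLambda β L / L) * ritzValue β v 0 * l2 ψ ψ)

/-! ## §2 The GEVP-free generator cuts: `DiagonalPlateauAt k` and the excited-sector cut `ExcitedPlateauAt k` -/

/-- **`DiagonalPlateauAt k` — level-`k` slice of the GEVP-free generator cut `KTGen.DiagonalPlateau`** (`DressedRitzGEVP.lean` §7): for every
`η > 0`, eventually in the window, `k+1` PHYSICAL UNIT generators `v_0 … v_k` with: (p0) sorted diagonal forms `d_0 ≥ … ≥ d_k`,
`d_i := qform(v_i,v_i)`; (p1) `|l2(v_i,v_l)| ≤ Cλ` (`i ≠ l`); (p2) one-step residuals `‖K v_i − d_i v_i‖² ≤ C(λ³/L²)d₀²`; (p3) `d_j μ₀ ≤ e^{Cλ²/L} μ_j d₀`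
and `μ_j d₀ ≤ e^{Cλ²/L} d_j μ₀`; (p4) `|qform(v_i,v_l) − ½(d_i+d_l) l2(v_i,v_l)| ≤ C(λ²/L)d₀` (`i ≠ l`); (p5) `d₀ − d_k ≤ C(λ/L)d₀`; (p6)
`qform(ψ,ψ) ≤ e^{ηλ/L} d₀ ‖ψ‖²` for physical `ψ`.  Every hypothesis is ONE NUMBER per pair of generators and Euclidean time `r ∈ {0,1,2}`.
[cite: LuscherWolff1990] -/
def KTGen.DiagonalPlateauAt (k : ℕ) : Prop :=
  ∀ η : ℝ, 0 < η → ∃ C lam0 : ℝ, 0 < lam0 ∧ ∀ lam : ℝ, 0 < lam → lam ≤ lam0 → ∃ L0 : ℕ,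
    ∀ (L : ℕ) [NeZero L], L0 ≤ L → ∀ β : ℝ, InFemtoWindow lam β L →
      ∃ v : Fin (k + 1) → (GaugeConfig 3 L SU2 → ℝ),
        (∀ i, IsPhys (v i)) ∧ (∀ i, l2 (v i) (v i) = 1) ∧
        (∀ i l : Fin (k + 1), i ≤ l → qform su2Rep β (v l) (v l) ≤ qform su2Rep β (v i) (v i)) ∧
        (∀ i l : Fin (k + 1), i ≠ l → |l2 (v i) (v l)| ≤ C * luscherLambda β L) ∧
        (∀ i, l2 (transferApply β (v i) - qform su2Rep β (v i) (v i) • v i)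
            (transferApply β (v i) - qform su2Rep β (v i) (v i) • v i)
            ≤ C * (luscherLambda β L ^ 3 / (L : ℝ) ^ 2) * qform su2Rep β (v 0) (v 0) ^ 2) ∧
        (∀ j : Fin (k + 1),
          qform su2Rep β (v j) (v j) * levelValue su2Rep 1 (oneSiteCoupling β L) 0 ≤
              Real.exp (C * luscherLambda β L ^ 2 / L) *
                (levelValue su2Rep 1 (oneSiteCoupling β L) j * qform su2Rep β (v 0) (v 0)) ∧
          levelValue su2Rep 1 (oneSiteCoupling β L) j * qform su2Rep β (v 0) (v 0) ≤
              Real.exp (C * luscherLambda β L ^ 2 / L) *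
                (qform su2Rep β (v j) (v j) * levelValue su2Rep 1 (oneSiteCoupling β L) 0)) ∧
        (∀ i l : Fin (k + 1), i ≠ l →
          |qform su2Rep β (v i) (v l) - (qform su2Rep β (v i) (v i) + qform su2Rep β (v l) (v l)) / 2 * l2 (v i) (v l)|
            ≤ C * (luscherLambda β L ^ 2 / L) * qform su2Rep β (v 0) (v 0)) ∧
        (qform su2Rep β (v 0) (v 0) - qform su2Rep β (v (Fin.last k)) (v (Fin.last k))
            ≤ C * (luscherLambda β L / L) * qform su2Rep β (v 0) (v 0)) ∧
        (∀ ψ : GaugeConfig 3 L SU2 → ℝ, IsPhys ψ →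
          qform su2Rep β ψ ψ ≤ Real.exp (η * luscherLambda β L / L) * qform su2Rep β (v 0) (v 0) * l2 ψ ψ)

/-- ★ **`ExcitedPlateauAt k` — level-`k` slice of the excited-sector cut `KTGen.ExcitedPlateau` (vacuum generator EXACT)** (`DressedRitzGEVP.lean`
§9): data on `k` EXCITED generators `w₀ … w_{k−1}` only (`w_i` sits at level `i+1`; no margin `η`, no top-capture clause): physical unit vectors
with (x1) sorted diagonal values `d_i = ⟨w_i,K_βw_i⟩`; (x2) near-orthogonality `|⟨w_i,w_l⟩| ≤ Cλ`; (x3) VACUUM OVERLAP: SOME physical unit top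
eigenvector `φ` (`K_βφ = λ₀φ`; the prover picks it, e.g. the Perron–Frobenius vector) has `|⟨φ,w_i⟩| ≤ Cλ`; (x4) one-step residuals
`‖K_βw_i − d_iw_i‖² ≤ C(λ³/L²)λ₀²`; (x5) `d_i` in Lüscher position against the EXACT `λ₀`: `d_i/λ₀ = (μ_{i+1}/μ₀)·e^{±Cλ²/L}`; (x6) symmetrised
excited couplings `≤ C(λ²/L)λ₀`; (x7) spread `λ₀ − d_i ≤ C(λ/L)λ₀`. [cite: Luscher1983, §3] -/
def KTGen.ExcitedPlateauAt (k : ℕ) : Prop :=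
  ∃ C lam0 : ℝ, 0 < lam0 ∧ ∀ lam : ℝ, 0 < lam → lam ≤ lam0 → ∃ L0 : ℕ,
    ∀ (L : ℕ) [NeZero L], L0 ≤ L → ∀ β : ℝ, InFemtoWindow lam β L →
      ∃ w : Fin k → (GaugeConfig 3 L SU2 → ℝ),
        (∀ i, IsPhys (w i)) ∧ (∀ i, l2 (w i) (w i) = 1) ∧
        (∀ i l : Fin k, i ≤ l → qform su2Rep β (w l) (w l) ≤ qform su2Rep β (w i) (w i)) ∧
        (∀ i l : Fin k, i ≠ l → |l2 (w i) (w l)| ≤ C * luscherLambda β L) ∧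
        (∃ φ : GaugeConfig 3 L SU2 → ℝ, IsPhys φ ∧ l2 φ φ = 1 ∧
            transferApply β φ = levelValue su2Rep L β 0 • φ ∧ ∀ i, |l2 φ (w i)| ≤ C * luscherLambda β L) ∧
        (∀ i, l2 (transferApply β (w i) - qform su2Rep β (w i) (w i) • w i)
            (transferApply β (w i) - qform su2Rep β (w i) (w i) • w i)
            ≤ C * (luscherLambda β L ^ 3 / (L : ℝ) ^ 2) * levelValue su2Rep L β 0 ^ 2) ∧
        (∀ i : Fin k,
          qform su2Rep β (w i) (w i) * levelValue su2Rep 1 (oneSiteCoupling β L) 0 ≤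
              Real.exp (C * luscherLambda β L ^ 2 / L) *
                (levelValue su2Rep 1 (oneSiteCoupling β L) ((i : ℕ) + 1) * levelValue su2Rep L β 0) ∧
          levelValue su2Rep 1 (oneSiteCoupling β L) ((i : ℕ) + 1) * levelValue su2Rep L β 0 ≤
              Real.exp (C * luscherLambda β L ^ 2 / L) *
                (qform su2Rep β (w i) (w i) * levelValue su2Rep 1 (oneSiteCoupling β L) 0)) ∧
        (∀ i l : Fin k, i ≠ l →
          |qform su2Rep β (w i) (w l) - (qform su2Rep β (w i) (w i) + qform su2Rep β (w l) (w l)) / 2 * l2 (w i) (w l)|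
            ≤ C * (luscherLambda β L ^ 2 / L) * levelValue su2Rep L β 0) ∧
        (∀ i : Fin k, levelValue su2Rep L β 0 - qform su2Rep β (w i) (w i)
            ≤ C * (luscherLambda β L / L) * levelValue su2Rep L β 0)

/-! ## §3 The cut in operator language: insertions, homogeneous clauses, `OrthoPlateauAt k`, `OperatorPlateauAt k` -/

/-- **`ins φ O = (O − ⟨φ, O·φ⟩)·φ`** — the insertion `O`, vacuum-subtracted with respect to the unit vector `φ` (the vacuum), applied to `φ`
(`OperatorPlateau.lean` §1). [cite: LuscherWolff1990] -/
def OpPlat.ins {L : ℕ} [NeZero L] (φ O : GaugeConfig 3 L SU2 → ℝ) : GaugeConfig 3 L SU2 → ℝ :=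
  (O - fun _ => l2 φ (O * φ)) * φ

/-- ★ **THE HOMOGENEOUS CLAUSES (o0)–(o7)** for `k` raw vectors `u_i` at coupling `β` with constant `C` (`OperatorPlateau.lean` §2, VERBATIM) —
write `n_i := ⟨u_i,u_i⟩`, `d_il := ⟨u_i, K_β u_l⟩`, `λ := luscherLambda β L`, `λ₀ := levelValue su2Rep L β 0`,
`μ_j := levelValue su2Rep 1 (oneSiteCoupling β L) j`: (o0) `n_i > 0`; (o1) ORDER `i ≤ l → d_ll·n_i ≤ d_ii·n_l`; (o2)
`|⟨u_i,u_l⟩| ≤ Cλ·√n_i√n_l` (`i ≠ l`); (o4) RESIDUAL `‖K_βu_i‖²·n_i − d_ii² ≤ C(λ³/L²)λ₀²·n_i²`; (o5) LÜSCHER POSITION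
`d_ii·μ₀ ≤ e^{Cλ²/L}(μ_{i+1}λ₀)·n_i` and `(μ_{i+1}λ₀)·n_i ≤ e^{Cλ²/L}·d_ii·μ₀`; (o6) COUPLING `|d_il − ½(d_ii/n_i + d_ll/n_l)⟨u_i,u_l⟩| ≤
C(λ²/L)λ₀·√n_i√n_l` (`i ≠ l`); (o7) SPREAD `λ₀·n_i − d_ii ≤ C(λ/L)λ₀·n_i`.  Every quantity is a vacuum-sector correlator of two vectors at time
separation `0, 1, 2` (`‖K_βu‖² = ⟨u, K_β²u⟩`). [cite: LuscherWolff1990] -/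
def OpPlat.PlateauClauses (k : ℕ) (C : ℝ) {L : ℕ} [NeZero L] (β : ℝ) (u : Fin k → (GaugeConfig 3 L SU2 → ℝ)) : Prop :=
  (∀ i : Fin k, 0 < l2 (u i) (u i)) ∧
  (∀ i l : Fin k, i ≤ l →
    l2 (u l) (transferApply β (u l)) * l2 (u i) (u i) ≤ l2 (u i) (transferApply β (u i)) * l2 (u l) (u l)) ∧
  (∀ i l : Fin k, i ≠ l →
    |l2 (u i) (u l)| ≤ C * luscherLambda β L * (Real.sqrt (l2 (u i) (u i)) * Real.sqrt (l2 (u l) (u l)))) ∧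
  (∀ i : Fin k,
    l2 (transferApply β (u i)) (transferApply β (u i)) * l2 (u i) (u i) - l2 (u i) (transferApply β (u i)) ^ 2
      ≤ C * (luscherLambda β L ^ 3 / (L : ℝ) ^ 2) * levelValue su2Rep L β 0 ^ 2 * l2 (u i) (u i) ^ 2) ∧
  (∀ i : Fin k,
    l2 (u i) (transferApply β (u i)) * levelValue su2Rep 1 (oneSiteCoupling β L) 0 ≤
        Real.exp (C * luscherLambda β L ^ 2 / L) *
          (levelValue su2Rep 1 (oneSiteCoupling β L) ((i : ℕ) + 1) * levelValue su2Rep L β 0) * l2 (u i) (u i) ∧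
    levelValue su2Rep 1 (oneSiteCoupling β L) ((i : ℕ) + 1) * levelValue su2Rep L β 0 * l2 (u i) (u i) ≤
        Real.exp (C * luscherLambda β L ^ 2 / L) *
          (l2 (u i) (transferApply β (u i)) * levelValue su2Rep 1 (oneSiteCoupling β L) 0)) ∧
  (∀ i l : Fin k, i ≠ l →
    |l2 (u i) (transferApply β (u l)) -
        (l2 (u i) (transferApply β (u i)) / l2 (u i) (u i) + l2 (u l) (transferApply β (u l)) / l2 (u l) (u l)) / 2 *
          l2 (u i) (u l)|
      ≤ C * (luscherLambda β L ^ 2 / L) * levelValue su2Rep L β 0 *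
          (Real.sqrt (l2 (u i) (u i)) * Real.sqrt (l2 (u l) (u l)))) ∧
  (∀ i : Fin k, levelValue su2Rep L β 0 * l2 (u i) (u i) - l2 (u i) (transferApply β (u i))
      ≤ C * (luscherLambda β L / L) * levelValue su2Rep L β 0 * l2 (u i) (u i))

/-- ★ **`OrthoPlateauAt k` — level-`k` slice of the cut in homogeneous form `OpPlat.OrthoPlateau`** (`OperatorPlateau.lean` §2): `C ≥ 0`,
`lam0 > 0`; in the femto window a physical unit top eigenvector `φ` of `K_β` and `k` physical vectors `u_i` EXACTLY orthogonal to `φ`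
satisfying `PlateauClauses` — no unit vectors, no (x3). [cite: Luscher1983, §3] -/
def OpPlat.OrthoPlateauAt (k : ℕ) : Prop :=
  ∃ C lam0 : ℝ, 0 ≤ C ∧ 0 < lam0 ∧ ∀ lam : ℝ, 0 < lam → lam ≤ lam0 → ∃ L0 : ℕ,
    ∀ (L : ℕ) [NeZero L], L0 ≤ L → ∀ β : ℝ, InFemtoWindow lam β L →
      ∃ φ : GaugeConfig 3 L SU2 → ℝ, IsPhys φ ∧ l2 φ φ = 1 ∧
        transferApply β φ = levelValue su2Rep L β 0 • φ ∧
      ∃ u : Fin k → (GaugeConfig 3 L SU2 → ℝ), (∀ i, IsPhys (u i)) ∧ (∀ i, l2 φ (u i) = 0) ∧ OpPlat.PlateauClauses k C β u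

/-- ★ **`OperatorPlateauAt k` — level-`k` slice of THE CUT IN OPERATOR LANGUAGE `OpPlat.OperatorPlateau`** (`OperatorPlateau.lean` §2): as
`OrthoPlateauAt k`, but the vectors are PRODUCED from `k` physical insertions, `u_i := ins φ O_i = (O_i − ⟨O_i⟩_φ)·φ` (orthogonality to `φ` is
then automatic).  In correlator words (memo `Lines/OperatorPlateau.md` §2): deep in the window produce `k` gauge-invariant zero-flux bounded
insertions `O_1 … O_k` and bound five kinds of vacuum numbers of `u_i` — `C_i(0) = n_i`, `C_il(0)`, `C_il(1) = d_il`, `C_i(2) = ‖K_βu_i‖²` — by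
(o0)–(o7): one-step effective masses in Lüscher position (o5), single-state dominance at `t = 1` (o4), channel separation (o2)/(o6), all channel
energies within `O(λ/L)` of the vacuum (o7).  This is what a prover working with a smeared-loop operator basis establishes; the estimates
themselves (RG ∕ cluster expansion of slab expectations, uniformly in the slab length) are the XL content of item 20205. [cite: LuscherWolff1990] -/
def OpPlat.OperatorPlateauAt (k : ℕ) : Prop :=
  ∃ C lam0 : ℝ, 0 ≤ C ∧ 0 < lam0 ∧ ∀ lam : ℝ, 0 < lam → lam ≤ lam0 → ∃ L0 : ℕ,
    ∀ (L : ℕ) [NeZero L], L0 ≤ L → ∀ β : ℝ, InFemtoWindow lam β L →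
      ∃ φ : GaugeConfig 3 L SU2 → ℝ, IsPhys φ ∧ l2 φ φ = 1 ∧
        transferApply β φ = levelValue su2Rep L β 0 • φ ∧
      ∃ O : Fin k → (GaugeConfig 3 L SU2 → ℝ), (∀ i, IsPhys (O i)) ∧
        OpPlat.PlateauClauses k C β (fun i => OpPlat.ins φ (O i))

end Summit.QuantumFields.YangMills.Theorems.FemtoTransferGap

end
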